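import Summits.BirchSwinnertonDyer.BirchSwinnertonDyer.Theorems.ManinLocalTwoThreeShimuraRationalThreeIsogeny
import Literature.NumberTheory.EllipticCurves.LatticeIndexThreeVeluProofs
import Literature.NumberTheory.EllipticCurves.ModularCurveNeronLatticeProofs
import HarnessLib

/-!
# Vélu rigidity at `3`: a tripled optimal pair (`|c₀| = 3|c₁|`, `9 ∣ N`) makes the MINIMAL model `W₁` the `u = 1` Vélu
# `3`-quotient of `W₀` by a rational `3`-isogeny kernel

Summit `BirchSwinnertonDyer`, route `ManinLocalTwoThree` (cell bsd-f2-manin), crux C3 `ManinPrimeToThreeAtNine`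
(stmt-BirchSwinnertonDyer-22968); the `3`-adic analogue of the Vélu step of `…BlindNoDoubling` (p634444), built on
`PeriodPair.lattice_eq_of_velu_three_invariants` (p638385) and the Shimura trichotomy at `9 ∣ N` (p637503).  This is the analytic
half of the an planner's dictionary DICT₃ «rational `3`-isogeny kernel `⟨T⟩` ↔ index-`3` superlattice» (MEMO-an §64.E): what is
left for the `3`-blind law NB₃ is purely `3`-adic arithmetic of the explicit invariants below.

* `velu_three_discr_ne_zero` — the Vélu invariants `g₂″ = 120x₀² − 9g₂`, `g₃″ = 280x₀³ − 42g₂x₀ − 27g₃` of a `Ψ₃`-root `x₀`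
  have `g₂″³ − 27g₃″² ≠ 0` (Bézout certificate `A·Δ″ + B·16Ψ₃ = 27Δ³`, compute job j309901);
* `velu_three_rigidity` — `W₀/ℚ` any model with Néron pair `L₀`, `L'` a period pair with RATIONAL invariants `A = g₂(L')`,
  `B = g₃(L')`, `Λ₀ ⊆ Λ' ⊆ Λ₀ ∪ (±z₀ + Λ₀)`, `z₀ ∈ Λ' ∖ Λ₀`, `3z₀ ∈ Λ₀`: then `q = ℘_{Λ₀}(z₀) ∈ ℚ`, `q − b₂/12` is a root of
  `W₀.Ψ₃`, and `A = 120q² − 9c₄(W₀)/12`, `B = 280q³ − 42(c₄(W₀)/12)q − 27c₆(W₀)/216` EXACTLY (no twist: `u = 1`);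
* `index_nine_or_velu_three_of_tripled` — for the optimal pair `(D₁, D₀)` of a class at `9 ∣ N` with `|c₀| = 3|c₁|`:
  `Λ₁(f) = 3Λ₀(f)`, or `∃ q`, `W₀.Ψ₃(q − b₂/12) = 0 ∧ c₄(W₁) = 1440q² − 9c₄(W₀) ∧ c₆(W₁) = 60480q³ − 756c₄(W₀)q − 27c₆(W₀)`;
* `velu_three_of_tripled_nine_mul_prime` — at `N = 9p`, `p ≡ 2 (mod 3)` (no index `9`): **tripling forces the globally
  minimal `W₁` to have exactly the Vélu invariants of `W₀` at a rational `3`-isogeny kernel.**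

HONEST FRAMING: structure only; C3, Manin's conjecture and BSD are not proved.  No definitions.
-/

set_option autoImplicit false
-- the summit-side namespace `Summit.BirchSwinnertonDyer.BirchSwinnertonDyer.…` is the tree's (summit = sub-problem)
set_option linter.dupNamespace false

noncomputable section

open WeierstrassCurve Literature.NumberTheory.EllipticCurves Literature.NumberTheory.EllipticCurves.ModularForms
open CongruenceSubgroup Polynomial

namespace Summit.BirchSwinnertonDyer.BirchSwinnertonDyer.Theorems.ManinLocalTwoThree

variable {W₁ W₀ : WeierstrassCurve ℚ} [W₁.IsElliptic] [W₁.IsGloballyMinimal] [W₀.IsElliptic]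
  [W₀.IsGloballyMinimal] {N : ℕ} [NeZero N]

/-! ### The Vélu `3`-quotient is nonsingular -/

/-- **`Δ` of the Vélu `3`-quotient is non-zero**: if `16Ψ₃(x₀) = 48x₀⁴ − 24g₂x₀² − 48g₃x₀ − g₂² = 0` and `g₂³ − 27g₃² ≠ 0` then
`(120x₀² − 9g₂)³ − 27(280x₀³ − 42g₂x₀ − 27g₃)² ≠ 0` (Bézout: `A·Δ″ + B·16Ψ₃ = 27(g₂³ − 27g₃²)³`). -/
theorem velu_three_discr_ne_zero {K : Type*} [Field K] [CharZero K] {x₀ g₂ g₃ : K}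
    (hψ : 48 * x₀ ^ 4 - 24 * g₂ * x₀ ^ 2 - 48 * g₃ * x₀ - g₂ ^ 2 = 0) (hΔ : g₂ ^ 3 - 27 * g₃ ^ 2 ≠ 0) :
    (120 * x₀ ^ 2 - 9 * g₂) ^ 3 - 27 * (280 * x₀ ^ 3 - 42 * g₂ * x₀ - 27 * g₃) ^ 2 ≠ 0 := by
  intro h0
  have h27 : (27 : K) * (g₂ ^ 3 - 27 * g₃ ^ 2) ^ 3 = 0 := by
    linear_combination (g₂ ^ 6 + 24 * g₂ ^ 5 * x₀ ^ 2 + 60 * g₂ ^ 4 * g₃ * x₀ + 36 * g₂ ^ 3 * g₃ ^ 2 +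
        432 * g₂ ^ 3 * g₃ * x₀ ^ 3 + 1656 * g₂ ^ 2 * g₃ ^ 2 * x₀ ^ 2 + 1836 * g₂ * g₃ ^ 3 * x₀ + 27 * g₃ ^ 4 +
        2160 * g₃ ^ 3 * x₀ ^ 3) * h0 +
      (-756 * g₂ ^ 7 - 17820 * g₂ ^ 6 * x₀ ^ 2 - 68688 * g₂ ^ 5 * g₃ * x₀ + 194400 * g₂ ^ 5 * x₀ ^ 4 -
        43740 * g₂ ^ 4 * g₃ ^ 2 + 19440 * g₂ ^ 4 * g₃ * x₀ ^ 3 - 1671840 * g₂ ^ 3 * g₃ ^ 2 * x₀ ^ 2 +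
        3499200 * g₂ ^ 3 * g₃ * x₀ ^ 5 - 2624400 * g₂ ^ 2 * g₃ ^ 3 * x₀ + 13413600 * g₂ ^ 2 * g₃ ^ 2 * x₀ ^ 4 -
        787320 * g₂ * g₃ ^ 4 + 12538800 * g₂ * g₃ ^ 3 * x₀ ^ 3 - 656100 * g₃ ^ 4 * x₀ ^ 2 +
        17496000 * g₃ ^ 3 * x₀ ^ 5) * hψ
  have h3 : (g₂ ^ 3 - 27 * g₃ ^ 2) ^ 3 = 0 := by
    rcases mul_eq_zero.mp h27 with h | h
    · norm_num at h
    · exact h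
  exact hΔ (pow_eq_zero_iff three_ne_zero |>.mp h3)

/-! ### From `℘_{Λ₀}(z₀) = q ∈ ℚ` to the `Ψ₃`-root and the `Ψ₃`-relation -/

omit [W₀.IsElliptic] [W₀.IsGloballyMinimal] in
/-- For a third-period `z₀` of the Néron lattice of `W₀` with `℘(z₀) = q ∈ ℚ`: `q − b₂/12` is a root of `W₀.Ψ₃`, and
`48q⁴ − 24g₂q² − 48g₃q − g₂² = 0` with `g₂ = c₄(W₀)/12`, `g₃ = c₆(W₀)/216`. -/
theorem Ψ₃_root_of_ratCast_eq_weierstrassP {L₀ : PeriodPair} (hL₀ : IsNeronLatticeOf (W₀.baseChange ℂ) L₀)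
    {z₀ : ℂ} (hz₀ : z₀ ∉ L₀.lattice) (h3 : 3 * z₀ ∈ L₀.lattice) {q : ℚ} (hq : (q : ℂ) = L₀.weierstrassP z₀) :
    W₀.Ψ₃.eval (q - W₀.b₂ / 12) = 0 ∧
      48 * q ^ 4 - 24 * (W₀.c₄ / 12) * q ^ 2 - 48 * (W₀.c₆ / 216) * q - (W₀.c₄ / 12) ^ 2 = 0 := by
  have hc₄ : (W₀.baseChange ℂ).c₄ = (W₀.c₄ : ℂ) := by simp [WeierstrassCurve.baseChange, WeierstrassCurve.map_c₄]
  have hc₆ : (W₀.baseChange ℂ).c₆ = (W₀.c₆ : ℂ) := by simp [WeierstrassCurve.baseChange, WeierstrassCurve.map_c₆]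
  have hg₂ : L₀.g₂ = ((W₀.c₄ / 12 : ℚ) : ℂ) := by rw [hL₀.1, hc₄]; push_cast; ring
  have hg₃ : L₀.g₃ = ((W₀.c₆ / 216 : ℚ) : ℂ) := by rw [hL₀.2, hc₆]; push_cast; ring
  have hrel := L₀.twelve_mul_weierstrassP_pow_four_sub_eq_zero_of_three_mul_mem hz₀ h3
  rw [← hq, hg₂, hg₃] at hrel
  have hrelQ : 12 * q ^ 4 - 6 * (W₀.c₄ / 12) * q ^ 2 - 12 * (W₀.c₆ / 216) * q - (W₀.c₄ / 12) ^ 2 / 4 = 0 := by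
    have h : ((12 * q ^ 4 - 6 * (W₀.c₄ / 12) * q ^ 2 - 12 * (W₀.c₆ / 216) * q - (W₀.c₄ / 12) ^ 2 / 4 : ℚ) : ℂ) = 0 := by
      push_cast at hrel ⊢; exact hrel
    exact_mod_cast h
  refine ⟨?_, by linear_combination 4 * hrelQ⟩
  -- `Ψ₃` of the short model vanishes at `q`; transport by the covariance `Ψ₃^{W}(x − b₂/12) = Ψ₃^{W_sh}(x)`
  rw [Ψ₃_eval_sub_b₂_div_twelve]
  simp only [WeierstrassCurve.Ψ₃, WeierstrassCurve.b₂, WeierstrassCurve.b₄, WeierstrassCurve.b₆, WeierstrassCurve.b₈,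
    eval_add, eval_mul, eval_pow, eval_C, eval_X, eval_ofNat]
  linear_combination (1 / 16 : ℚ) * (4 * hrelQ)

/-! ### Vélu rigidity -/

omit [W₀.IsGloballyMinimal] in
/-- **Vélu rigidity at `3`.**  `W₀/ℚ` elliptic (any model) with Néron-type pair `L₀`; `L'` a period pair with RATIONAL
invariants `g₂(L') = A`, `g₃(L') = B`; `Λ₀ ⊆ Λ'` of index `3` generated by `z₀` (`z₀ ∈ Λ' ∖ Λ₀`, `3z₀ ∈ Λ₀`,
`Λ' ⊆ Λ₀ ∪ (±z₀ + Λ₀)`).  Then `q = ℘_{Λ₀}(z₀) ∈ ℚ`, `q − b₂/12` is a root of `W₀.Ψ₃`, and `(A, B)` ARE Vélu's invariants: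
`A = 120q² − 9·c₄(W₀)/12`, `B = 280q³ − 42(c₄(W₀)/12)q − 27·c₆(W₀)/216`. -/
theorem velu_three_rigidity {L₀ : PeriodPair} (hL₀ : IsNeronLatticeOf (W₀.baseChange ℂ) L₀) (L' : PeriodPair)
    {A B : ℚ} (hA : (A : ℂ) = L'.g₂) (hB : (B : ℂ) = L'.g₃) (hle : L₀.lattice ≤ L'.lattice)
    {z₀ : ℂ} (hz₀' : z₀ ∈ L'.lattice) (hz₀ : z₀ ∉ L₀.lattice) (h3 : 3 * z₀ ∈ L₀.lattice)
    (hidx : ∀ w ∈ L'.lattice, w ∈ L₀.lattice ∨ w - z₀ ∈ L₀.lattice ∨ w + z₀ ∈ L₀.lattice) :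
    ∃ q : ℚ, (q : ℂ) = L₀.weierstrassP z₀ ∧ W₀.Ψ₃.eval (q - W₀.b₂ / 12) = 0 ∧
      A = 120 * q ^ 2 - 9 * (W₀.c₄ / 12) ∧ B = 280 * q ^ 3 - 42 * (W₀.c₄ / 12) * q - 27 * (W₀.c₆ / 216) := by
  have hc₄ : (W₀.baseChange ℂ).c₄ = (W₀.c₄ : ℂ) := by simp [WeierstrassCurve.baseChange, WeierstrassCurve.map_c₄]
  have hc₆ : (W₀.baseChange ℂ).c₆ = (W₀.c₆ : ℂ) := by simp [WeierstrassCurve.baseChange, WeierstrassCurve.map_c₆]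
  have hg₂ : L₀.g₂ = ((W₀.c₄ / 12 : ℚ) : ℂ) := by rw [hL₀.1, hc₄]; push_cast; ring
  have hg₃ : L₀.g₃ = ((W₀.c₆ / 216 : ℚ) : ℂ) := by rw [hL₀.2, hc₆]; push_cast; ring
  obtain ⟨q, hq⟩ := L₀.exists_ratCast_eq_weierstrassP_of_index_three L' hle ⟨_, hg₂.symm⟩ ⟨_, hg₃.symm⟩
    ⟨A, hA⟩ ⟨B, hB⟩ hz₀' hz₀ hidx
  obtain ⟨hroot, hrel⟩ := Ψ₃_root_of_ratCast_eq_weierstrassP hL₀ hz₀ h3 hq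
  refine ⟨q, hq, hroot, ?_⟩
  -- the rational Vélu model and its Néron pair
  set g₂' : ℚ := W₀.c₄ / 12 with hg₂'
  set g₃' : ℚ := W₀.c₆ / 216 with hg₃'
  set a : ℚ := 120 * q ^ 2 - 9 * g₂' with ha
  set b : ℚ := 280 * q ^ 3 - 42 * g₂' * q - 27 * g₃' with hb
  have hΔ₀ : g₂' ^ 3 - 27 * g₃' ^ 2 ≠ 0 := by
    have hΔW : W₀.Δ ≠ 0 := by rw [← WeierstrassCurve.coe_Δ']; exact W₀.Δ'.ne_zero
    intro h0; apply hΔW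
    have hc := W₀.c_relation
    rw [hg₂', hg₃'] at h0
    linear_combination hc / 1728 + h0
  have hΔV : a ^ 3 - 27 * b ^ 2 ≠ 0 := velu_three_discr_ne_zero hrel hΔ₀
  set V : WeierstrassCurve ℚ := ⟨0, 0, 0, -a / 4, -b / 4⟩ with hV
  have hVc₄ : V.c₄ = 12 * a := by
    simp only [hV, WeierstrassCurve.c₄, WeierstrassCurve.b₂, WeierstrassCurve.b₄]; ring
  have hVc₆ : V.c₆ = 216 * b := by
    simp only [hV, WeierstrassCurve.c₆, WeierstrassCurve.b₂, WeierstrassCurve.b₄, WeierstrassCurve.b₆]; ring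
  have hVΔ : V.Δ = a ^ 3 - 27 * b ^ 2 := by
    simp only [hV, WeierstrassCurve.Δ, WeierstrassCurve.b₂, WeierstrassCurve.b₄, WeierstrassCurve.b₆, WeierstrassCurve.b₈]
    ring
  haveI : V.IsElliptic := ⟨isUnit_iff_ne_zero.mpr (by rw [hVΔ]; exact hΔV)⟩
  haveI : (V.baseChange ℂ).IsElliptic := by rw [WeierstrassCurve.baseChange]; infer_instance
  obtain ⟨LV, hLV⟩ := exists_isNeronLatticeOf_holds (V.baseChange ℂ)
  have hc₄V : (V.baseChange ℂ).c₄ = (V.c₄ : ℂ) := by simp [WeierstrassCurve.baseChange, WeierstrassCurve.map_c₄]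
  have hc₆V : (V.baseChange ℂ).c₆ = (V.c₆ : ℂ) := by simp [WeierstrassCurve.baseChange, WeierstrassCurve.map_c₆]
  have h₂V : LV.g₂ = 120 * L₀.weierstrassP z₀ ^ 2 - 9 * L₀.g₂ := by
    rw [hLV.1, hc₄V, hVc₄, ← hq, hg₂, ha]; push_cast; ring
  have h₃V : LV.g₃ = 280 * L₀.weierstrassP z₀ ^ 3 - 42 * L₀.g₂ * L₀.weierstrassP z₀ - 27 * L₀.g₃ := by
    rw [hLV.2, hc₆V, hVc₆, ← hq, hg₂, hg₃, hb]; push_cast; ring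
  -- Vélu's lattice is `Λ₀ + ℤz₀ = Λ'`
  obtain ⟨hleV, hz₀V, hidxV⟩ := L₀.lattice_eq_of_velu_three_invariants hz₀ h3 LV h₂V h₃V
  have hΛ : LV.lattice = L'.lattice := by
    ext w
    constructor
    · intro hw
      rcases hidxV w hw with h0 | h0 | h0
      · exact hle h0
      · have e' : w = (w - z₀) + z₀ := by ring
        rw [e']; exact add_mem (hle h0) hz₀'
      · have e' : w = (w + z₀) - z₀ := by ring
        rw [e']; exact sub_mem (hle h0) hz₀'
    · intro hw
      rcases hidx w hw with h0 | h0 | h0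
      · exact hleV h0
      · have e' : w = (w - z₀) + z₀ := by ring
        rw [e']; exact add_mem (hleV h0) hz₀V
      · have e' : w = (w + z₀) - z₀ := by ring
        rw [e']; exact sub_mem (hleV h0) hz₀V
  have hA' : (A : ℂ) = ((a : ℚ) : ℂ) := by
    rw [hA, ← PeriodPair.g₂_eq_of_lattice_eq hΛ, hLV.1, hc₄V, hVc₄]; push_cast; ring
  have hB' : (B : ℂ) = ((b : ℚ) : ℂ) := by
    rw [hB, ← PeriodPair.g₃_eq_of_lattice_eq hΛ, hLV.2, hc₆V, hVc₆]; push_cast; ring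
  exact ⟨by exact_mod_cast hA', by exact_mod_cast hB'⟩

/-! ### The tripled optimal pair at `9 ∣ N` -/

/-- **Tripled ⟹ index `9` or Vélu rigidity.**  For the optimal `X₁(N)`-datum `D₁` and the optimal `X₀(N)`-datum `D₀` of a
class at `9 ∣ N` with `|c₀| = 3|c₁|`: either `Λ₁(f) = 3Λ₀(f)`, or there is `q ∈ ℚ` with `W₀.Ψ₃(q − b₂/12) = 0` (a rational
`3`-isogeny kernel `⟨T⟩`, `x(T) = q − b₂/12`) such that the globally minimal `W₁` has EXACTLY the Vélu invariants
`c₄(W₁) = 1440q² − 9c₄(W₀)`, `c₆(W₁) = 60480q³ − 756c₄(W₀)q − 27c₆(W₀)` (`E₁ = E₀/⟨T⟩` with `u = 1`). -/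
theorem index_nine_or_velu_three_of_tripled (D₁ : Gamma1ParametrizationData W₁ N)
    (D₀ : ModularParametrizationData W₀ N) (hiso : IsIsogenous W₁ W₀) (h₁ : D₁.IsOptimal)
    (h₀ : ∀ z ∈ D₀.L.lattice, ∃ w ∈ periodLattice D₀.f, z = D₀.c * w) (h9 : 3 ^ 2 ∣ N)
    (htri : D₀.maninConstant.natAbs = 3 * D₁.maninConstant.natAbs) :
    (∀ z : ℂ, z ∈ periodLatticeGamma1 D₀.f ↔ ∃ w ∈ periodLattice D₀.f, z = 3 * w) ∨
      ∃ q : ℚ, W₀.Ψ₃.eval (q - W₀.b₂ / 12) = 0 ∧ W₁.c₄ = 1440 * q ^ 2 - 9 * W₀.c₄ ∧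
        W₁.c₆ = 60480 * q ^ 3 - 756 * W₀.c₄ * q - 27 * W₀.c₆ := by
  have hf : D₁.f = D₀.f := D₁.f_eq_of_isIsogenous D₀ hiso
  have hc₁ : (D₁.c : ℂ) ≠ 0 := by exact_mod_cast D₁.maninConstant_ne_zero
  have hc₄W₁ : (W₁.baseChange ℂ).c₄ = (W₁.c₄ : ℂ) := by simp [WeierstrassCurve.baseChange, WeierstrassCurve.map_c₄]
  have hc₆W₁ : (W₁.baseChange ℂ).c₆ = (W₁.c₆ : ℂ) := by simp [WeierstrassCurve.baseChange, WeierstrassCurve.map_c₆]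
  have hA : ((W₁.c₄ / 12 : ℚ) : ℂ) = D₁.L.g₂ := by rw [D₁.isNeronLattice.1, hc₄W₁]; push_cast; ring
  have hB : ((W₁.c₆ / 216 : ℚ) : ℂ) = D₁.L.g₃ := by rw [D₁.isNeronLattice.2, hc₆W₁]; push_cast; ring
  -- Ling–Oesterlé at `3`
  have h3Λ : ∀ w ∈ periodLattice D₀.f, (3 : ℂ) * w ∈ periodLatticeGamma1 D₀.f := fun w hw ↦ by
    have h := pMulLatticeLeGamma1OfTracelessPrime_holds N D₀.f D₀.isNewformOf.1 3 Nat.prime_three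
      ((dvd_pow_self 3 two_ne_zero).trans h9) (D₀.isNewformOf.1.cuspCoeff_eq_zero_of_sq_dvd Nat.prime_three h9) w hw
    exact_mod_cast h
  obtain ⟨ε, hε, hcc⟩ : ∃ ε : ℂ, (ε = 1 ∨ ε = -1) ∧ (D₀.c : ℂ) = ε * (3 * D₁.c) := by
    have h : D₀.maninConstant.natAbs = (3 * D₁.maninConstant).natAbs := by rw [htri, Int.natAbs_mul]; rfl
    rcases Int.natAbs_eq_natAbs_iff.mp h with h' | h'
    · exact ⟨1, Or.inl rfl, by rw [one_mul]; exact_mod_cast h'⟩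
    · exact ⟨-1, Or.inr rfl, by rw [neg_one_mul]; exact_mod_cast h'⟩
  have hε2 : ε * ε = 1 := by rcases hε with rfl | rfl <;> norm_num
  have hεmem : ∀ (S : AddSubgroup ℂ) (w : ℂ), w ∈ S → ε * w ∈ S := by
    intro S w hw; rcases hε with rfl | rfl
    · rwa [one_mul]
    · rw [neg_one_mul]; exact neg_mem hw
  have hle : D₀.L.lattice ≤ D₁.L.lattice := by
    intro z hz
    obtain ⟨w, hw, rfl⟩ := h₀ z hz
    have e : (D₀.c : ℂ) * w = (D₁.c : ℂ) * (ε * (3 * w)) := by rw [hcc]; ring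
    rw [e]
    exact D₁.smul_periodLatticeGamma1_le _ (hεmem _ _ (by rw [hf]; exact h3Λ w hw))
  have hthree : ∀ w ∈ D₁.L.lattice, 3 * w ∈ D₀.L.lattice := by
    intro w hw
    obtain ⟨w₁, hw₁, rfl⟩ := h₁ w hw
    have hw₀ : ε * w₁ ∈ periodLattice D₀.f := hεmem _ _ (hf ▸ periodLatticeGamma1_le_periodLattice D₁.f hw₁)
    have e : 3 * ((D₁.c : ℂ) * w₁) = (D₀.c : ℂ) * (ε * w₁) := by
      rw [hcc]; linear_combination -(3 * (D₁.c : ℂ) * w₁) * hε2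
    rw [e]; exact D₀.smul_periodLattice_le _ hw₀
  rcases thirdLattice_trichotomy D₀.L D₁.L hle hthree with hcase | hcase | hcase
  · -- `Λ_{E₁} = Λ_{E₀}`: index 9
    left
    refine fun z ↦ ⟨fun hz ↦ ?_, by rintro ⟨w, hw, rfl⟩; exact h3Λ w hw⟩
    have hz' : (D₁.c : ℂ) * z ∈ D₀.L.lattice := hcase _ (D₁.smul_periodLatticeGamma1_le z (hf ▸ hz))
    obtain ⟨w, hw, hw'⟩ := h₀ _ hz'
    refine ⟨ε * w, hεmem _ _ hw, ?_⟩
    have h : (D₁.c : ℂ) * z = (D₁.c : ℂ) * (3 * (ε * w)) := by rw [hw', hcc]; ring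
    exact mul_left_cancel₀ hc₁ h
  · -- `Λ_{E₁} ⊇ ⅓Λ_{E₀}`: `Λ₁ = Λ₀`, so `|c₀| = |c₁|`, contradicting `|c₀| = 3|c₁| ≠ 0`
    exfalso
    have hΛ : periodLatticeGamma1 D₀.f = periodLattice D₀.f := by
      refine le_antisymm (periodLatticeGamma1_le_periodLattice D₀.f) fun w hw ↦ ?_
      have h3h : 3 * (ε * ((D₁.c : ℂ) * w)) ∈ D₀.L.lattice := by
        have e : 3 * (ε * ((D₁.c : ℂ) * w)) = (D₀.c : ℂ) * w := by rw [hcc]; ring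
        rw [e]; exact D₀.smul_periodLattice_le w hw
      obtain ⟨w₁, hw₁, hw₁'⟩ := h₁ _ (hcase _ h3h)
      have hw' : w = ε * w₁ := by
        have h : (D₁.c : ℂ) * w = (D₁.c : ℂ) * (ε * w₁) := by
          linear_combination ε * hw₁' - ((D₁.c : ℂ) * w) * hε2
        exact mul_left_cancel₀ hc₁ h
      rw [hw', ← hf]; exact hεmem _ _ hw₁
    have heq := natAbs_maninConstant₀_eq_of_periodLatticeGamma1_eq_periodLattice D₁ D₀ h₁ h₀ hf hΛ
    have hne : D₁.maninConstant.natAbs ≠ 0 := Int.natAbs_ne_zero.mpr D₁.maninConstant_ne_zero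
    omega
  · -- index 3: Vélu rigidity with `L' = Λ_{E₁}`, the Néron lattice of the minimal model `W₁`
    right
    obtain ⟨z₀, hz₀', hz₀, hidx⟩ := hcase
    obtain ⟨q, -, hroot, hA', hB'⟩ :=
      velu_three_rigidity D₀.isNeronLattice D₁.L hA hB hle hz₀' hz₀ (hthree z₀ hz₀') hidx
    refine ⟨q, hroot, ?_, ?_⟩
    · linear_combination 12 * hA'
    · linear_combination 216 * hB'

/-- **At `N = 9p`, `p ≡ 2 (mod 3)`: tripling forces Vélu rigidity** — for the optimal pair of a class with `|c₀| = 3|c₁|`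
there is a rational `3`-isogeny kernel `⟨T⟩` of `W₀`, `x(T) = q − b₂/12`, with `c₄(W₁) = 1440q² − 9c₄(W₀)` and
`c₆(W₁) = 60480q³ − 756c₄(W₀)q − 27c₆(W₀)` on the MINIMAL model `W₁` (index `9` being impossible at these levels). -/
theorem velu_three_of_tripled_nine_mul_prime {p : ℕ} (hp : p.Prime) (hp3 : p % 3 = 2) [NeZero (9 * p)]
    (D₁ : Gamma1ParametrizationData W₁ (9 * p)) (D₀ : ModularParametrizationData W₀ (9 * p))
    (hiso : IsIsogenous W₁ W₀) (h₁ : D₁.IsOptimal)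
    (h₀ : ∀ z ∈ D₀.L.lattice, ∃ w ∈ periodLattice D₀.f, z = D₀.c * w)
    (htri : D₀.maninConstant.natAbs = 3 * D₁.maninConstant.natAbs) :
    ∃ q : ℚ, W₀.Ψ₃.eval (q - W₀.b₂ / 12) = 0 ∧ W₁.c₄ = 1440 * q ^ 2 - 9 * W₀.c₄ ∧
      W₁.c₆ = 60480 * q ^ 3 - 756 * W₀.c₄ * q - 27 * W₀.c₆ := by
  rcases index_nine_or_velu_three_of_tripled D₁ D₀ hiso h₁ h₀ ⟨p, rfl⟩ htri with h | h
  · exact absurd h (not_periodLatticeGamma1_eq_three_mul_of_nine_mul_prime hp hp3 D₀ h₀)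
  · exact h

/-! ### E-an-68 at `9`: index `9` forces `3 ∣ c₀`; so C3 on `D₀` leaves only index `1` or a rational `3`-isogeny -/

/-- **Index `9` forces `|c₀| = 3|c₁|`** (the `3`-adic twin of E-an-68 `GammaOneIndexFourForcesEvenManin`): if
`Λ₁(f₁) = 3Λ₀(f₀)` then `Λ_{W₁} = 3c₁Λ₀ = (3c₁/c₀)Λ_{W₀}`, a rational homothety between minimal models, so `c₀ = ±3c₁`. -/
theorem natAbs_maninConstant₀_eq_three_mul_of_index_nine
    (D₁ : Gamma1ParametrizationData W₁ N) (D₀ : ModularParametrizationData W₀ N) (h₁ : D₁.IsOptimal)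
    (h₀ : ∀ z ∈ D₀.L.lattice, ∃ w ∈ periodLattice D₀.f, z = D₀.c * w)
    (hidx : ∀ z : ℂ, z ∈ periodLatticeGamma1 D₁.f ↔ ∃ w ∈ periodLattice D₀.f, z = 3 * w) :
    D₀.maninConstant.natAbs = 3 * D₁.maninConstant.natAbs := by
  have hidx' : ∀ z : ℂ, z ∈ periodLatticeGamma1 D₁.f ↔ ∃ w ∈ periodLattice D₀.f, z = ((3 : ℤ) : ℂ) * w := by
    intro z
    rw [hidx z, Int.cast_ofNat]
  simpa using natAbs_maninConstant₀_eq_mul_of_periodLatticeGamma1_eq_mul D₁ D₀ h₁ h₀ 3 hidx'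

/-- **Index `9` forces `3 ∣ c₀`.** -/
theorem three_dvd_maninConstant₀_of_index_nine
    (D₁ : Gamma1ParametrizationData W₁ N) (D₀ : ModularParametrizationData W₀ N) (h₁ : D₁.IsOptimal)
    (h₀ : ∀ z ∈ D₀.L.lattice, ∃ w ∈ periodLattice D₀.f, z = D₀.c * w)
    (hidx : ∀ z : ℂ, z ∈ periodLatticeGamma1 D₁.f ↔ ∃ w ∈ periodLattice D₀.f, z = 3 * w) :
    (3 : ℤ) ∣ D₀.maninConstant := by
  have h := natAbs_maninConstant₀_eq_three_mul_of_index_nine D₁ D₀ h₁ h₀ hidx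
  have h3 : (3 : ℤ).natAbs ∣ D₀.maninConstant.natAbs := ⟨D₁.maninConstant.natAbs, by simpa using h⟩
  exact Int.natAbs_dvd_natAbs.mp h3

/-- Contrapositive: **`3 ∤ c₀ ⟹ Λ₁(f) ≠ 3Λ₀(f)`** — a necessary condition for C3, from in-tree ingredients only. -/
theorem index_ne_nine_of_not_three_dvd_maninConstant
    (D₁ : Gamma1ParametrizationData W₁ N) (D₀ : ModularParametrizationData W₀ N) (h₁ : D₁.IsOptimal)
    (h₀ : ∀ z ∈ D₀.L.lattice, ∃ w ∈ periodLattice D₀.f, z = D₀.c * w) (hnd : ¬ (3 : ℤ) ∣ D₀.maninConstant) :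
    ¬ (∀ z : ℂ, z ∈ periodLatticeGamma1 D₁.f ↔ ∃ w ∈ periodLattice D₀.f, z = 3 * w) :=
  fun hidx ↦ hnd (three_dvd_maninConstant₀_of_index_nine D₁ D₀ h₁ h₀ hidx)

/-- **Under C3 for `D₀` (`3 ∤ c₀`) at `9 ∣ N`, for every level: `Λ₁(f) = Λ₀(f)` (and `|c₀| = |c₁|`), or `W₀` admits a
rational `3`-isogeny** (the index-`9` branch of `trichotomy_shimura_of_nine_dvd_level` is killed by `3 ∤ c₀`). -/
theorem periodLatticeGamma1_eq_or_exists_Ψ₃_root_of_not_three_dvd (D₁ : Gamma1ParametrizationData W₁ N)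
    (D₀ : ModularParametrizationData W₀ N) (hiso : IsIsogenous W₁ W₀) (h₁ : D₁.IsOptimal)
    (h₀ : ∀ z ∈ D₀.L.lattice, ∃ w ∈ periodLattice D₀.f, z = D₀.c * w) (h9 : 3 ^ 2 ∣ N)
    (hnd : ¬ (3 : ℤ) ∣ D₀.maninConstant) :
    (periodLatticeGamma1 D₀.f = periodLattice D₀.f ∧ D₀.maninConstant.natAbs = D₁.maninConstant.natAbs) ∨
      ∃ x : ℚ, W₀.Ψ₃.eval x = 0 := by
  have hf : D₁.f = D₀.f := D₁.f_eq_of_isIsogenous D₀ hiso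
  rcases trichotomy_shimura_of_nine_dvd_level D₁ D₀ hiso h₁ h₀ h9 with h | h | h
  · exact Or.inl ⟨h, natAbs_maninConstant₀_eq_of_periodLatticeGamma1_eq_periodLattice D₁ D₀ h₁ h₀ hf h⟩
  · have h' : ∀ z : ℂ, z ∈ periodLatticeGamma1 D₁.f ↔ ∃ w ∈ periodLattice D₀.f, z = 3 * w := fun z ↦ by
      rw [hf]; exact h z
    exact absurd h' (index_ne_nine_of_not_three_dvd_maninConstant D₁ D₀ h₁ h₀ hnd)
  · exact Or.inr h

end Summit.BirchSwinnertonDyer.BirchSwinnertonDyer.Theorems.ManinLocalTwoThree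

end
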